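import Literature.Analysis.UnboundedOperators.LinearizedBoltzmannFrequencyBounds
import Literature.Analysis.UnboundedOperators.LinearizedBoltzmannBurnettProofs
import Literature.Analysis.FluidPDE.LambertCosineLaw
import HarnessLib

/-!
# The sharp lower bound `ν(v) ≥ π|v|` and the flux moment of the quartic weight (`ℝ³`)

Two angular/flux computations for the linearised hard-sphere operator of `ℝ³` around the normalised
Maxwellian `M` (`LinearizedBoltzmann.lean`, CIP 1994 §7.2), both instances of Archimedes' hat-box theorem
in flux form (`Literature.Analysis.FluidPDE.lintegral_toSphere_cos_comp_coords`, `lintegral_toSphere_cos`):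

* `pi_mul_norm_le_collisionFrequency` — **`ν(v) ≥ π |v|`**, the sharp large-speed lower bound of the
  hard-sphere collision frequency `ν(v) = ∫∫ ((v - w)·ω)₊ dω dM(w)` (Jensen / symmetrisation `w ↦ -w` of
  the centred Maxwellian: `((v-w)·ω)₊ + ((v+w)·ω)₊ ≥ 2(v·ω)₊`, then `∫ (v·ω)₊ dω = π|v|`,
  `sphereIntegral_hardSphereKernel_zero`). The tree had `ν ≥ s₀|v|` with an inexplicit `s₀`
  (`exists_pos_mul_norm_le_collisionFrequency`); the sharp constant `π` is what makes the polynomial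
  weights `(1 + |v|²)^k`, `k > 1`, supersolutions of Grad's integral equation.
* `lintegral_toSphere_posPart_mul_quartic_le` — `∫ (v·ω)₊ (1 + |v|² - (v·ω)²)² dω ≤ π(1 + |v|²)³/(3|v|)`:
  under the flux law the quantity `1 - (v̂·ω)²` is uniform on `[0,1]`
  (`setLIntegral_ball_one_add_mul_norm_sq_sq_le`, polar coordinates in `ℝ²`).

Also: `hardSphereKernel_le_posPart_add_norm` (`((v-w)·ω)₊ ≤ (v·ω)₊ + |w|`). No new definitions.
-/

open MeasureTheory Metric Real Set Filter Topology ProbabilityTheory Module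
open scoped InnerProductSpace ENNReal

namespace Literature.Analysis.UnboundedOperators

noncomputable section

open Literature.MathematicalPhysics.KineticTheory (collide sphereMeasure hardSphereKernel)
open Literature.Analysis.FluidPDE

/-! ### The sharp lower bound `ν(v) ≥ π |v|` of the collision frequency (`ℝ³`) -/

/-- `∫_{S²} (v·ω)₊ dσ(ω) = π |v|` (the total flux through a hemisphere, `lintegral_toSphere_cos`).
[folklore] -/
theorem sphereIntegral_hardSphereKernel_zero (v : EuclideanSpace ℝ (Fin 3)) :
    ∫ ω, hardSphereKernel (v, 0) ω ∂sphereMeasure = Real.pi * ‖v‖ := by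
  by_cases hv : v = 0
  · subst hv
    simp [hardSphereKernel]
  have hvn : 0 < ‖v‖ := norm_pos_iff.2 hv
  set a : EuclideanSpace ℝ (Fin 3) := ‖v‖⁻¹ • v with ha_def
  have ha : ‖a‖ = 1 := by rw [ha_def, norm_smul, norm_inv, norm_norm, inv_mul_cancel₀ hvn.ne']
  have hva : v = ‖v‖ • a := by rw [ha_def, smul_smul, mul_inv_cancel₀ hvn.ne', one_smul]
  have hpt : ∀ ω : sphere (0 : EuclideanSpace ℝ (Fin 3)) 1,
      hardSphereKernel (v, 0) ω = ‖v‖ * max ⟪a, (ω : EuclideanSpace ℝ (Fin 3))⟫_ℝ 0 := by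
    intro ω
    have hinner : ⟪v, (ω : EuclideanSpace ℝ (Fin 3))⟫_ℝ = ‖v‖ * ⟪a, (ω : EuclideanSpace ℝ (Fin 3))⟫_ℝ := by
      conv_lhs => rw [hva]
      rw [real_inner_smul_left]
    simp only [hardSphereKernel, sub_zero]
    rw [hinner, mul_max_of_nonneg _ _ hvn.le, mul_zero]
  simp_rw [hpt]
  rw [integral_const_mul]
  have hnn : 0 ≤ᵐ[sphereMeasure] fun ω : sphere (0 : EuclideanSpace ℝ (Fin 3)) 1 =>
      max ⟪a, (ω : EuclideanSpace ℝ (Fin 3))⟫_ℝ 0 := Eventually.of_forall fun ω => le_max_right _ _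
  have hm : AEStronglyMeasurable (fun ω : sphere (0 : EuclideanSpace ℝ (Fin 3)) 1 =>
      max ⟪a, (ω : EuclideanSpace ℝ (Fin 3))⟫_ℝ 0) sphereMeasure :=
    (Continuous.max (continuous_const.inner continuous_subtype_val) continuous_const).aestronglyMeasurable
  rw [integral_eq_lintegral_of_nonneg_ae hnn hm]
  have hof : ∀ ω : sphere (0 : EuclideanSpace ℝ (Fin 3)) 1,
      ENNReal.ofReal (max ⟪a, (ω : EuclideanSpace ℝ (Fin 3))⟫_ℝ 0) = ENNReal.ofReal ⟪a, (ω : EuclideanSpace ℝ (Fin 3))⟫_ℝ := by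
    intro ω
    rcases le_total ⟪a, (ω : EuclideanSpace ℝ (Fin 3))⟫_ℝ 0 with h | h
    · rw [max_eq_right h, ENNReal.ofReal_zero, ENNReal.ofReal_of_nonpos h]
    · rw [max_eq_left h]
  simp_rw [hof]
  have h := lintegral_toSphere_cos ha
  rw [show (sphereMeasure : Measure (sphere (0 : EuclideanSpace ℝ (Fin 3)) 1)) = volume.toSphere from rfl, h,
    ENNReal.toReal_ofReal Real.pi_pos.le, mul_comm]

/-- Convexity of the positive part at symmetric points:
`((v - w)·ω)₊ + ((v + w)·ω)₊ ≥ 2 (v·ω)₊`. [folklore] -/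
theorem two_mul_hardSphereKernel_zero_le (v w : EuclideanSpace ℝ (Fin 3))
    (ω : sphere (0 : EuclideanSpace ℝ (Fin 3)) 1) :
    2 * hardSphereKernel (v, 0) ω ≤ hardSphereKernel (v, w) ω + hardSphereKernel (v, -w) ω := by
  simp only [hardSphereKernel, sub_zero, sub_neg_eq_add, inner_sub_left, inner_add_left]
  rcases le_total ⟪v, (ω : EuclideanSpace ℝ (Fin 3))⟫_ℝ 0 with h | h
  · rw [max_eq_right h, mul_zero]
    exact add_nonneg (le_max_right _ _) (le_max_right _ _)
  · rw [max_eq_left h]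
    linarith [le_max_left (⟪v, (ω : EuclideanSpace ℝ (Fin 3))⟫_ℝ - ⟪w, (ω : EuclideanSpace ℝ (Fin 3))⟫_ℝ) 0,
      le_max_left (⟪v, (ω : EuclideanSpace ℝ (Fin 3))⟫_ℝ + ⟪w, (ω : EuclideanSpace ℝ (Fin 3))⟫_ℝ) 0]

/-- **The sharp lower bound of the hard-sphere collision frequency of `ℝ³`: `ν(v) ≥ π |v|`**
(Jensen: `∫ ((v - w)·ω)₊ dM(w) ≥ ((v - ∫ w dM)·ω)₊ = (v·ω)₊`, here via the symmetrisation `w ↦ -w`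
of the centred Maxwellian, then the total flux `∫ (v·ω)₊ dω = π|v|`). [folklore] -/
theorem pi_mul_norm_le_collisionFrequency (v : EuclideanSpace ℝ (Fin 3)) :
    Real.pi * ‖v‖ ≤ collisionFrequency v := by
  haveI := isFiniteMeasure_sphereMeasure (E := EuclideanSpace ℝ (Fin 3))
  set s : EuclideanSpace ℝ (Fin 3) → ℝ := fun w => ∫ ω, hardSphereKernel (v, w) ω ∂sphereMeasure with hs
  have hsi : Integrable s (stdGaussian (EuclideanSpace ℝ (Fin 3))) := integrable_sphereIntegral_hardSphereKernel v
  have hsym : ∫ w, s (-w) ∂stdGaussian (EuclideanSpace ℝ (Fin 3)) = ∫ w, s w ∂stdGaussian (EuclideanSpace ℝ (Fin 3)) := by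
    have := integral_comp_linearIsometryEquiv_stdGaussian (LinearIsometryEquiv.neg ℝ) s
    simpa using this
  have hsi' : Integrable (fun w => s (-w)) (stdGaussian (EuclideanSpace ℝ (Fin 3))) := by
    have hmp : MeasurePreserving (LinearIsometryEquiv.neg ℝ : EuclideanSpace ℝ (Fin 3) ≃ₗᵢ[ℝ] EuclideanSpace ℝ (Fin 3))
        (stdGaussian (EuclideanSpace ℝ (Fin 3))) (stdGaussian (EuclideanSpace ℝ (Fin 3))) :=
      ⟨(LinearIsometryEquiv.neg ℝ).continuous.measurable, stdGaussian_map _⟩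
    have := (hmp.integrable_comp_emb (LinearIsometryEquiv.neg ℝ).toHomeomorph.measurableEmbedding).2 hsi
    simpa [Function.comp_def] using this
  have hpt : ∀ w, 2 * s 0 ≤ s w + s (-w) := by
    intro w
    have hc : ∀ u : EuclideanSpace ℝ (Fin 3), Continuous fun ω : sphere (0 : EuclideanSpace ℝ (Fin 3)) 1 =>
        hardSphereKernel (v, u) ω := fun u => by unfold hardSphereKernel; fun_prop
    have hi : ∀ u : EuclideanSpace ℝ (Fin 3), Integrable (fun ω : sphere (0 : EuclideanSpace ℝ (Fin 3)) 1 =>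
        hardSphereKernel (v, u) ω) sphereMeasure :=
      fun u => (hc u).integrable_of_hasCompactSupport (HasCompactSupport.of_compactSpace _)
    simp only [hs]
    rw [← integral_add (hi w) (hi (-w)), ← integral_const_mul]
    exact integral_mono ((hi 0).const_mul 2) ((hi w).add (hi (-w))) fun ω => two_mul_hardSphereKernel_zero_le v w ω
  have h2 : 2 * (Real.pi * ‖v‖) ≤ 2 * collisionFrequency v := by
    calc 2 * (Real.pi * ‖v‖) = ∫ _ : EuclideanSpace ℝ (Fin 3), 2 * s 0 ∂stdGaussian (EuclideanSpace ℝ (Fin 3)) := by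
          rw [integral_const, probReal_univ, one_smul, hs]
          simp only [sphereIntegral_hardSphereKernel_zero]
      _ ≤ ∫ w, (s w + s (-w)) ∂stdGaussian (EuclideanSpace ℝ (Fin 3)) :=
          integral_mono (integrable_const _) (hsi.add hsi') hpt
      _ = 2 * collisionFrequency v := by
          rw [integral_add hsi hsi', hsym, collisionFrequency, ← hs]; ring
  linarith

/-- `((v - w)·ω)₊ ≤ (v·ω)₊ + |w|`. [folklore] -/
theorem hardSphereKernel_le_posPart_add_norm (v w : EuclideanSpace ℝ (Fin 3))
    (ω : sphere (0 : EuclideanSpace ℝ (Fin 3)) 1) :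
    hardSphereKernel (v, w) ω ≤ hardSphereKernel (v, 0) ω + ‖w‖ := by
  have h1 : |⟪w, (ω : EuclideanSpace ℝ (Fin 3))⟫_ℝ| ≤ ‖w‖ := abs_inner_sphere_le w ω
  simp only [hardSphereKernel, sub_zero, inner_sub_left]
  rw [abs_le] at h1
  refine max_le ?_ (add_nonneg (le_max_right _ _) (norm_nonneg _))
  linarith [le_max_left ⟪v, (ω : EuclideanSpace ℝ (Fin 3))⟫_ℝ 0]

/-! ### The flux moment `∫ (v·ω)₊ (1 + |v|² - (v·ω)²)² dω` -/

/-- `∫₀¹ y (1 + c y²)² dy = ((1 + c)³ - 1)/(6c)` for `c ≠ 0`. [folklore] -/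
theorem integral_mul_one_add_mul_sq_sq {c : ℝ} (hc : c ≠ 0) :
    ∫ y in (0 : ℝ)..1, y * (1 + c * y ^ 2) ^ 2 = ((1 + c) ^ 3 - 1) / (6 * c) := by
  have hderiv : ∀ y ∈ uIcc (0 : ℝ) 1,
      HasDerivAt (fun y => (1 + c * y ^ 2) ^ 3 / (6 * c)) (y * (1 + c * y ^ 2) ^ 2) y := by
    intro y _
    have hsq : HasDerivAt (fun x : ℝ => x ^ 2) (2 * y) y := by simpa using hasDerivAt_pow 2 y
    have h1 : HasDerivAt (fun x : ℝ => 1 + c * x ^ 2) (2 * c * y) y :=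
      ((hsq.const_mul c).const_add 1).congr_deriv (by ring)
    have h6c : (6 : ℝ) * c ≠ 0 := by positivity
    exact ((h1.pow 3).div_const (6 * c)).congr_deriv (by field_simp; ring)
  rw [intervalIntegral.integral_eq_sub_of_hasDerivAt hderiv
    ((by fun_prop : Continuous fun y : ℝ => y * (1 + c * y ^ 2) ^ 2).intervalIntegrable 0 1)]
  field_simp
  ring

/-- **`∫_{|p|<1} (1 + c|p|²)² dp = π ((1+c)³ - 1)/(3c) ≤ π (1 + c)³/(3c)`** on `ℝ²` (`c > 0`; polar
coordinates). [folklore] -/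
theorem setLIntegral_ball_one_add_mul_norm_sq_sq_le {c : ℝ} (hc : 0 < c) :
    ∫⁻ p in ball (0 : EuclideanSpace ℝ (Fin 2)) 1, ENNReal.ofReal ((1 + c * ‖p‖ ^ 2) ^ 2) ≤
      ENNReal.ofReal (Real.pi * (1 + c) ^ 3 / (3 * c)) := by
  set G : ℝ → ℝ := fun y => (1 + c * y ^ 2) ^ 2 with hG
  have hGc : Continuous G := by rw [hG]; fun_prop
  have hrad : ∀ p : EuclideanSpace ℝ (Fin 2), (ball (0 : EuclideanSpace ℝ (Fin 2)) 1).indicator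
      (fun p => G ‖p‖) p = (Iio (1 : ℝ)).indicator G ‖p‖ := by
    intro p
    by_cases hp : p ∈ ball (0 : EuclideanSpace ℝ (Fin 2)) 1
    · have hp' : ‖p‖ ∈ Iio (1 : ℝ) := by simpa using hp
      rw [indicator_of_mem hp, indicator_of_mem hp']
    · have hp' : ‖p‖ ∉ Iio (1 : ℝ) := by simpa using hp
      rw [indicator_of_notMem hp, indicator_of_notMem hp']
  have hint : IntegrableOn (fun p : EuclideanSpace ℝ (Fin 2) => G ‖p‖) (ball 0 1) volume :=
    ((hGc.comp continuous_norm).continuousOn.integrableOn_compact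
      (isCompact_closedBall (0 : EuclideanSpace ℝ (Fin 2)) 1)).mono_set ball_subset_closedBall
  have hnn : 0 ≤ᵐ[volume.restrict (ball (0 : EuclideanSpace ℝ (Fin 2)) 1)]
      fun p : EuclideanSpace ℝ (Fin 2) => G ‖p‖ := Eventually.of_forall fun p => sq_nonneg _
  rw [← ofReal_integral_eq_lintegral_ofReal hint hnn]
  refine ENNReal.ofReal_le_ofReal ?_
  rw [← integral_indicator measurableSet_ball, funext hrad,
    integral_fun_norm_addHaar (volume : Measure (EuclideanSpace ℝ (Fin 2))) ((Iio (1 : ℝ)).indicator G)]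
  have h1d : ∫ y in Ioi (0 : ℝ), y ^ (Module.finrank ℝ (EuclideanSpace ℝ (Fin 2)) - 1) • (Iio (1 : ℝ)).indicator G y =
      ((1 + c) ^ 3 - 1) / (6 * c) := by
    rw [finrank_euclideanSpace_fin, show 2 - 1 = 1 from rfl]
    simp only [pow_one, smul_eq_mul]
    have hind : ∀ y : ℝ, y * (Iio (1 : ℝ)).indicator G y = (Iio (1 : ℝ)).indicator (fun y => y * G y) y := by
      intro y
      by_cases hy : y ∈ Iio (1 : ℝ)
      · rw [indicator_of_mem hy, indicator_of_mem hy]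
      · rw [indicator_of_notMem hy, indicator_of_notMem hy, mul_zero]
    simp_rw [hind]
    rw [setIntegral_indicator measurableSet_Iio, show Ioi (0 : ℝ) ∩ Iio 1 = Ioo 0 1 from rfl,
      ← integral_Ioc_eq_integral_Ioo, ← intervalIntegral.integral_of_le zero_le_one,
      integral_mul_one_add_mul_sq_sq hc.ne']
  rw [h1d, finrank_euclideanSpace_fin, Measure.real, EuclideanSpace.volume_ball_fin_two,
    ENNReal.ofReal_one, one_pow, one_mul, ENNReal.toReal_ofReal Real.pi_pos.le, nsmul_eq_mul, smul_eq_mul]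
  rw [show (2 : ℕ) * (Real.pi * (((1 + c) ^ 3 - 1) / (6 * c))) = Real.pi * (1 + c) ^ 3 / (3 * c) - Real.pi / (3 * c) by
    push_cast; field_simp; ring]
  have : 0 ≤ Real.pi / (3 * c) := by positivity
  linarith

/-- **The flux moment of the quartic weight**: for `v ≠ 0`,
`∫_{S²} (v·ω)₊ (1 + |v|² - (v·ω)²)² dσ(ω) ≤ π (1 + |v|²)³ / (3|v|)` — Archimedes' hat-box theorem:
under the flux law `(v̂·ω)₊ dσ/π` the quantity `1 - (v̂·ω)²` is uniform on `[0, 1]`, and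
`∫₀¹ (1 + |v|² s)² ds = ((1 + |v|²)³ - 1)/(3|v|²)`. This is the sharp asymptotics `(2/3) ν(v) Φ(v)` of the
gain operator on `Φ = (1 + |·|²)²` behind the eigenvalue `λ = 4/(α+2)` at `α = 4`. [folklore] -/
theorem lintegral_toSphere_posPart_mul_quartic_le {v : EuclideanSpace ℝ (Fin 3)} (hv : v ≠ 0) :
    ∫⁻ ω : sphere (0 : EuclideanSpace ℝ (Fin 3)) 1, ENNReal.ofReal (hardSphereKernel (v, 0) ω *
        (1 + ‖v‖ ^ 2 - ⟪v, (ω : EuclideanSpace ℝ (Fin 3))⟫_ℝ ^ 2) ^ 2) ∂(volume.toSphere) ≤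
      ENNReal.ofReal (Real.pi * (1 + ‖v‖ ^ 2) ^ 3 / (3 * ‖v‖)) := by
  have hvn : 0 < ‖v‖ := norm_pos_iff.2 hv
  set a : EuclideanSpace ℝ (Fin 3) := ‖v‖⁻¹ • v with ha_def
  have ha : ‖a‖ = 1 := by rw [ha_def, norm_smul, norm_inv, norm_norm, inv_mul_cancel₀ hvn.ne']
  have hva : v = ‖v‖ • a := by rw [ha_def, smul_smul, mul_inv_cancel₀ hvn.ne', one_smul]
  set c : ℝ := ‖v‖ ^ 2 with hc
  have hc0 : 0 < c := by positivity
  have hf : Measurable fun p : EuclideanSpace ℝ (Fin 2) => ENNReal.ofReal ((1 + c * ‖p‖ ^ 2) ^ 2) :=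
    (by fun_prop : Continuous fun p : EuclideanSpace ℝ (Fin 2) => (1 + c * ‖p‖ ^ 2) ^ 2).measurable.ennreal_ofReal
  have h := lintegral_toSphere_cos_comp_coords ha hf
  have hpt : ∀ ω : sphere (0 : EuclideanSpace ℝ (Fin 3)) 1,
      ENNReal.ofReal (hardSphereKernel (v, 0) ω * (1 + c - ⟪v, (ω : EuclideanSpace ℝ (Fin 3))⟫_ℝ ^ 2) ^ 2) =
        ENNReal.ofReal ‖v‖ * (ENNReal.ofReal ⟪a, (ω : EuclideanSpace ℝ (Fin 3))⟫_ℝ *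
          ENNReal.ofReal ((1 + c * ‖Lambert.coords a ω‖ ^ 2) ^ 2)) := by
    intro ω
    have hinner : ⟪v, (ω : EuclideanSpace ℝ (Fin 3))⟫_ℝ = ‖v‖ * ⟪a, (ω : EuclideanSpace ℝ (Fin 3))⟫_ℝ := by
      conv_lhs => rw [hva]
      rw [real_inner_smul_left]
    have hX : 1 + c - ⟪v, (ω : EuclideanSpace ℝ (Fin 3))⟫_ℝ ^ 2 = 1 + c * ‖Lambert.coords a ω‖ ^ 2 := by
      rw [Lambert.norm_sq_coords ha, norm_eq_of_mem_sphere ω, hinner, hc]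
      ring
    have hK : hardSphereKernel (v, 0) ω = ‖v‖ * max ⟪a, (ω : EuclideanSpace ℝ (Fin 3))⟫_ℝ 0 := by
      simp only [hardSphereKernel, sub_zero]
      rw [hinner, mul_max_of_nonneg _ _ hvn.le, mul_zero]
    have hof : ENNReal.ofReal (max ⟪a, (ω : EuclideanSpace ℝ (Fin 3))⟫_ℝ 0) =
        ENNReal.ofReal ⟪a, (ω : EuclideanSpace ℝ (Fin 3))⟫_ℝ := by
      rcases le_total ⟪a, (ω : EuclideanSpace ℝ (Fin 3))⟫_ℝ 0 with h | h
      · rw [max_eq_right h, ENNReal.ofReal_zero, ENNReal.ofReal_of_nonpos h]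
      · rw [max_eq_left h]
    rw [hX, hK, ENNReal.ofReal_mul (mul_nonneg hvn.le (le_max_right _ _)), ENNReal.ofReal_mul hvn.le, hof,
      mul_assoc]
  simp_rw [hpt]
  rw [lintegral_const_mul' _ _ ENNReal.ofReal_ne_top, h]
  calc ENNReal.ofReal ‖v‖ * ∫⁻ p in ball (0 : EuclideanSpace ℝ (Fin 2)) 1, ENNReal.ofReal ((1 + c * ‖p‖ ^ 2) ^ 2)
      ≤ ENNReal.ofReal ‖v‖ * ENNReal.ofReal (Real.pi * (1 + c) ^ 3 / (3 * c)) :=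
        mul_le_mul' le_rfl (setLIntegral_ball_one_add_mul_norm_sq_sq_le hc0)
    _ = ENNReal.ofReal (Real.pi * (1 + ‖v‖ ^ 2) ^ 3 / (3 * ‖v‖)) := by
        rw [← ENNReal.ofReal_mul hvn.le, hc]
        congr 1
        field_simp

end

end Literature.Analysis.UnboundedOperators
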